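import Summits.ValiantsHypothesis.ValiantsHypothesis.Theorems.LacunarySymmetroidMatrixDescartesVSQKit

/-!
# `MatrixDescartes` census, `m = 3` row — KIT for the tridiagonal «Viro + square splitting» law: three-term sign rules

HONEST FRAMING.  Elementary real inequalities (val-V1-extremal engine seat val-v1x-eng-6 g2) for the all-`K` law of the `m = 3` row
(`…VSQTriLaw`: `ζ_sym(3,K) ≥ 7K − 13`).  Nothing here mentions the crux `MatrixDescartes` (stmt-ValiantsHypothesis-18050) or `VP ≠ VNP`.

CONTENT.  The determinant of a symmetric tridiagonal `3 × 3` matrix with diagonal `P₀, P₁, P₂` and links `Q₀, Q₁` is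
`E = P₀P₁P₂ − Q₀²P₂ − Q₁²P₀` (three matching terms).  Pure-real sign rules with «certificates» of the shape produced by
`…VSQKit.abs_bnom_sub_le` / `abs_bnom_le`:
* `U3_real` — if each `Pᵢ` is within `Vᵢ/8` of `sᵢVᵢ` (`|sᵢ| = 1`), `|Q₀| ≤ q₀`, `|Q₁| ≤ q₁` and both links are WEAK
  (`16 q₀² ≤ V₀V₁`, `16 q₁² ≤ V₁V₂`), then `s₀s₁s₂ · E > 0` (covers the bracketed zeros of a link: `qᵢ = 0`);
* `W3_real` — if the link `Q₀` is within `V_q/8` of `s_qV_q`, `P₂` within `V₂/8` of `s₂V₂`, `|P₀| ≤ p₀`, `|P₁| ≤ p₁`,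
  `|Q₁| ≤ q₁`, the link `0` is STRONG (`16 p₀p₁ ≤ V_q²`) and the link `1` weak against it (`16 q₁² ≤ p₁V₂`), then `−s₂ · E > 0`
  (the strong link at `1` is the same statement with `P₀ ↔ P₂`, `Q₀ ↔ Q₁`);
* bookkeeping helpers: `bnom_hconst` / `bnom_hshift` / `bnom_smul` (shifting all heights by a constant multiplies by `B^{−c}`;
  shifting by `c·d_l` rescales `t ↦ B^{−c} t`), `below_mono` (term bounds move along an interval), `pow_gap16` (the integer
  gap `2E + 1 ≤ A + C` gives `16 (K B^E)² ≤ B^A B^C` once `B ≥ 16K²`), `cert_of_dom` (`|f − sV| ≤ V/8` from dominance once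
  `B ≥ 8K`).
[folklore] Elementary.
-/

set_option linter.dupNamespace false
set_option autoImplicit false

namespace Summit.ValiantsHypothesis.ValiantsHypothesis.Theorems.LacunarySymmetroidMatrixDescartes.VSQ

open scoped BigOperators
open Finset

/-! ## 1. Pure-real three-term sign rules -/

/-- from `|P − sV| ≤ V/8`, `|s| = 1`: `7V/8 ≤ sP ≤ 9V/8` and `|P| ≤ 9V/8`. [folklore] -/
theorem cert_bounds {P s V : ℝ} (hs : |s| = 1) (h : |P - s * V| ≤ V / 8) :
    7 * V / 8 ≤ s * P ∧ s * P ≤ 9 * V / 8 ∧ |P| ≤ 9 * V / 8 := by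
  have hss : s * s = 1 := by rw [← abs_mul_abs_self, hs, one_mul]
  have e : s * P = V + s * (P - s * V) := by
    have : s * (s * V) = V := by rw [← mul_assoc, hss, one_mul]
    rw [mul_sub, this]; ring
  have hb : |s * (P - s * V)| ≤ V / 8 := by rw [abs_mul, hs, one_mul]; exact h
  obtain ⟨h1, h2⟩ := abs_le.1 hb
  refine ⟨by linarith, by linarith, ?_⟩
  have : |P| = |s * P| := by rw [abs_mul, hs, one_mul]
  rw [this]
  have hV : 0 ≤ V := by
    have := abs_nonneg (P - s * V); linarith
  rw [abs_le]; constructor <;> linarith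

/-- **U-rule for three matching terms** (both links weak): `s₀s₁s₂·(P₀P₁P₂ − Q₀²P₂ − Q₁²P₀) > 0`. [folklore] -/
theorem U3_real {P0 P1 P2 Q0 Q1 V0 V1 V2 q0 q1 s0 s1 s2 : ℝ} (hV0 : 0 < V0) (hV1 : 0 < V1) (hV2 : 0 < V2)
    (hs0 : |s0| = 1) (hs1 : |s1| = 1) (hs2 : |s2| = 1)
    (hP0 : |P0 - s0 * V0| ≤ V0 / 8) (hP1 : |P1 - s1 * V1| ≤ V1 / 8) (hP2 : |P2 - s2 * V2| ≤ V2 / 8)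
    (hQ0 : |Q0| ≤ q0) (hQ1 : |Q1| ≤ q1) (hg0 : 16 * q0 ^ 2 ≤ V0 * V1) (hg1 : 16 * q1 ^ 2 ≤ V1 * V2) :
    0 < s0 * s1 * s2 * (P0 * P1 * P2 - Q0 ^ 2 * P2 - Q1 ^ 2 * P0) := by
  obtain ⟨a0l, -, p0u⟩ := cert_bounds hs0 hP0
  obtain ⟨a1l, a1u, -⟩ := cert_bounds hs1 hP1
  obtain ⟨a2l, -, p2u⟩ := cert_bounds hs2 hP2
  -- main term
  have h01 : (7 * V0 / 8) * (7 * V1 / 8) ≤ (s0 * P0) * (s1 * P1) :=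
    mul_le_mul a0l a1l (by positivity) (le_trans (by positivity) a0l)
  have h012 : (7 * V0 / 8) * (7 * V1 / 8) * (7 * V2 / 8) ≤ (s0 * P0) * (s1 * P1) * (s2 * P2) :=
    mul_le_mul h01 a2l (by positivity) (le_trans (by positivity) h01)
  -- error terms
  have hq0 : 0 ≤ q0 := le_trans (abs_nonneg _) hQ0
  have hq1 : 0 ≤ q1 := le_trans (abs_nonneg _) hQ1
  have hQ0sq : Q0 ^ 2 ≤ q0 ^ 2 := by rw [← sq_abs Q0]; exact pow_le_pow_left₀ (abs_nonneg _) hQ0 2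
  have hQ1sq : Q1 ^ 2 ≤ q1 ^ 2 := by rw [← sq_abs Q1]; exact pow_le_pow_left₀ (abs_nonneg _) hQ1 2
  have t2 : |Q0 ^ 2 * P2| ≤ (V0 * V1 / 16) * (9 * V2 / 8) := by
    rw [abs_mul, abs_of_nonneg (sq_nonneg Q0)]
    exact mul_le_mul (by linarith) p2u (abs_nonneg _) (by positivity)
  have t3 : |Q1 ^ 2 * P0| ≤ (V1 * V2 / 16) * (9 * V0 / 8) := by
    rw [abs_mul, abs_of_nonneg (sq_nonneg Q1)]
    exact mul_le_mul (by linarith) p0u (abs_nonneg _) (by positivity)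
  have hS : |s0 * s1 * s2| = 1 := by rw [abs_mul, abs_mul, hs0, hs1, hs2]; norm_num
  have e : s0 * s1 * s2 * (P0 * P1 * P2 - Q0 ^ 2 * P2 - Q1 ^ 2 * P0) =
      (s0 * P0) * (s1 * P1) * (s2 * P2) - s0 * s1 * s2 * (Q0 ^ 2 * P2) - s0 * s1 * s2 * (Q1 ^ 2 * P0) := by ring
  have b2 : s0 * s1 * s2 * (Q0 ^ 2 * P2) ≤ (V0 * V1 / 16) * (9 * V2 / 8) := by
    calc s0 * s1 * s2 * (Q0 ^ 2 * P2) ≤ |s0 * s1 * s2 * (Q0 ^ 2 * P2)| := le_abs_self _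
      _ = |Q0 ^ 2 * P2| := by rw [abs_mul, hS, one_mul]
      _ ≤ _ := t2
  have b3 : s0 * s1 * s2 * (Q1 ^ 2 * P0) ≤ (V1 * V2 / 16) * (9 * V0 / 8) := by
    calc s0 * s1 * s2 * (Q1 ^ 2 * P0) ≤ |s0 * s1 * s2 * (Q1 ^ 2 * P0)| := le_abs_self _
      _ = |Q1 ^ 2 * P0| := by rw [abs_mul, hS, one_mul]
      _ ≤ _ := t3
  rw [e]
  nlinarith [mul_pos (mul_pos hV0 hV1) hV2]

/-- **W-rule for three matching terms** (link `0` strong, link `1` weak): `−s₂·(P₀P₁P₂ − Q₀²P₂ − Q₁²P₀) > 0`. [folklore] -/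
theorem W3_real {P0 P1 P2 Q0 Q1 Vq V2 p0 p1 q1 sq s2 : ℝ} (hVq : 0 < Vq) (hV2 : 0 < V2)
    (hsq : |sq| = 1) (hs2 : |s2| = 1) (hQ0 : |Q0 - sq * Vq| ≤ Vq / 8) (hP2 : |P2 - s2 * V2| ≤ V2 / 8)
    (hP0 : |P0| ≤ p0) (hP1 : |P1| ≤ p1) (hQ1 : |Q1| ≤ q1) (hp1 : 0 ≤ p1)
    (hgs : 16 * (p0 * p1) ≤ Vq ^ 2) (hgw : 16 * q1 ^ 2 ≤ p1 * V2) :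
    0 < s2 * (Q0 ^ 2 * P2 + Q1 ^ 2 * P0 - P0 * P1 * P2) := by
  obtain ⟨aql, -, -⟩ := cert_bounds hsq hQ0
  obtain ⟨a2l, -, p2u⟩ := cert_bounds hs2 hP2
  have hp0 : 0 ≤ p0 := le_trans (abs_nonneg _) hP0
  have hq1 : 0 ≤ q1 := le_trans (abs_nonneg _) hQ1
  -- Q0² ≥ (7Vq/8)²
  have hQ0abs : 7 * Vq / 8 ≤ |Q0| := by
    calc 7 * Vq / 8 ≤ sq * Q0 := aql
      _ ≤ |sq * Q0| := le_abs_self _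
      _ = |Q0| := by rw [abs_mul, hsq, one_mul]
  have hQ0sq : (7 * Vq / 8) ^ 2 ≤ Q0 ^ 2 := by
    rw [← sq_abs Q0]; exact pow_le_pow_left₀ (by positivity) hQ0abs 2
  have main : (7 * Vq / 8) ^ 2 * (7 * V2 / 8) ≤ Q0 ^ 2 * (s2 * P2) :=
    mul_le_mul hQ0sq a2l (by positivity) (sq_nonneg _)
  -- error terms
  have hQ1sq : Q1 ^ 2 ≤ q1 ^ 2 := by rw [← sq_abs Q1]; exact pow_le_pow_left₀ (abs_nonneg _) hQ1 2
  have t3 : |Q1 ^ 2 * P0| ≤ (p1 * V2 / 16) * p0 := by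
    rw [abs_mul, abs_of_nonneg (sq_nonneg Q1)]
    exact mul_le_mul (by linarith) hP0 (abs_nonneg _) (by positivity)
  have t1 : |P0 * P1 * P2| ≤ p0 * p1 * (9 * V2 / 8) := by
    rw [abs_mul, abs_mul]
    exact mul_le_mul (mul_le_mul hP0 hP1 (abs_nonneg _) hp0) p2u (abs_nonneg _) (by positivity)
  have e : s2 * (Q0 ^ 2 * P2 + Q1 ^ 2 * P0 - P0 * P1 * P2) =
      Q0 ^ 2 * (s2 * P2) + s2 * (Q1 ^ 2 * P0) - s2 * (P0 * P1 * P2) := by ring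
  have b3 : -((p1 * V2 / 16) * p0) ≤ s2 * (Q1 ^ 2 * P0) := by
    have h1 := neg_abs_le (s2 * (Q1 ^ 2 * P0))
    rw [abs_mul, hs2, one_mul] at h1
    linarith
  have b1 : s2 * (P0 * P1 * P2) ≤ p0 * p1 * (9 * V2 / 8) := by
    calc s2 * (P0 * P1 * P2) ≤ |s2 * (P0 * P1 * P2)| := le_abs_self _
      _ = |P0 * P1 * P2| := by rw [abs_mul, hs2, one_mul]
      _ ≤ _ := t1
  rw [e]
  nlinarith [mul_pos (pow_pos hVq 2) hV2, mul_nonneg (mul_nonneg hp0 hp1) hV2.le]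

/-! ## 2. Bookkeeping helpers -/

variable {K : ℕ}

/-- dominance gives the certificate `|f − sV| ≤ V/8` once `B ≥ 8K`. [folklore] -/
theorem cert_of_dom {B : ℝ} (h8 : 8 * (K : ℝ) ≤ B) (hB : 0 < B) {s : Fin K → ℝ} (hs : ∀ l, |s l| ≤ 1)
    (h : Fin K → ℤ) (d : Fin K → ℕ) {t : ℝ} (ht : 0 < t) (l₀ : Fin K) (hdom : Dom B s h d t l₀) :
    |bnom B s h d t - s l₀ * tv B (h l₀) (d l₀) t| ≤ tv B (h l₀) (d l₀) t / 8 := by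
  have hq : (K : ℝ) / B ≤ 1 / 8 := by rw [div_le_iff₀ hB]; linarith
  calc |bnom B s h d t - s l₀ * tv B (h l₀) (d l₀) t| ≤ (K : ℝ) / B * tv B (h l₀) (d l₀) t :=
        abs_bnom_sub_le hB hs h d ht l₀ hdom
    _ ≤ 1 / 8 * tv B (h l₀) (d l₀) t := mul_le_mul_of_nonneg_right hq (tv_pos hB _ _ ht).le
    _ = tv B (h l₀) (d l₀) t / 8 := by ring

/-- a common height offset `−c` multiplies by `B^{−c}`. [folklore] -/
theorem bnom_hconst {B : ℝ} (hB : B ≠ 0) (s : Fin K → ℝ) (h : Fin K → ℤ) (d : Fin K → ℕ) (c : ℤ) (t : ℝ) :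
    bnom B s (fun l => h l - c) d t = B ^ (-c) * bnom B s h d t := by
  unfold bnom tv
  rw [Finset.mul_sum]
  refine Finset.sum_congr rfl fun l _ => ?_
  rw [zpow_sub₀ hB, zpow_neg, div_eq_mul_inv]
  ring

/-- a height shift by `c·d_l` rescales the variable: `t ↦ B^{−c} t`. [folklore] -/
theorem bnom_hshift {B : ℝ} (hB : B ≠ 0) (s : Fin K → ℝ) (h : Fin K → ℤ) (d : Fin K → ℕ) (c : ℤ) (t : ℝ) :
    bnom B s (fun l => h l - c * d l) d t = bnom B s h d (B ^ (-c) * t) := by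
  unfold bnom tv
  refine Finset.sum_congr rfl fun l _ => ?_
  rw [zpow_sub₀ hB, mul_pow, ← zpow_natCast (B ^ (-c)) (d l), ← zpow_mul, neg_mul, zpow_neg, div_eq_mul_inv]
  ring

/-- a common sign factor comes out. [folklore] -/
theorem bnom_smul {B : ℝ} (g : ℝ) (s : Fin K → ℝ) (h : Fin K → ℤ) (d : Fin K → ℕ) (t : ℝ) :
    bnom B (fun l => g * s l) h d t = g * bnom B s h d t := by
  unfold bnom
  rw [Finset.mul_sum]
  exact Finset.sum_congr rfl fun l _ => by ring

/-- term sizes increase with `t`. [folklore] -/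
theorem tv_mono {B : ℝ} (hB : 0 < B) (h : ℤ) (d : ℕ) {t₁ t₂ : ℝ} (ht₁ : 0 ≤ t₁) (h12 : t₁ ≤ t₂) :
    tv B h d t₁ ≤ tv B h d t₂ :=
  mul_le_mul_of_nonneg_left (pow_le_pow_left₀ ht₁ h12 d) (zpow_pos hB h).le

/-- `Below` transfers to the left along an interval. [folklore] -/
theorem below_mono {B : ℝ} (hB : 0 < B) {s : Fin K → ℝ} {h : Fin K → ℤ} {d : Fin K → ℕ} {t t₂ M : ℝ} (ht : 0 ≤ t)
    (h2 : t ≤ t₂) (hb : Below B s h d t₂ M) : Below B s h d t M := by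
  intro l
  rcases hb l with h0 | hle
  · exact Or.inl h0
  · exact Or.inr ((tv_mono hB _ _ ht h2).trans hle)

/-- monomial comparison moves right when the right-hand degree is larger. [folklore] -/
theorem mono_cmp_right {c₁ c₂ t₁ t : ℝ} {a b : ℕ} (hc₂ : 0 ≤ c₂) (hab : a ≤ b) (ht₁ : 0 < t₁) (htt : t₁ ≤ t)
    (H : c₁ * t₁ ^ a ≤ c₂ * t₁ ^ b) : c₁ * t ^ a ≤ c₂ * t ^ b := by
  obtain ⟨r, rfl⟩ := Nat.exists_eq_add_of_le hab
  rw [pow_add] at H ⊢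
  have h1 : c₁ ≤ c₂ * t₁ ^ r := by
    have H' : c₁ * t₁ ^ a ≤ (c₂ * t₁ ^ r) * t₁ ^ a := by
      calc c₁ * t₁ ^ a ≤ c₂ * (t₁ ^ a * t₁ ^ r) := H
        _ = (c₂ * t₁ ^ r) * t₁ ^ a := by ring
    exact le_of_mul_le_mul_right H' (pow_pos ht₁ _)
  have h2 : c₂ * t₁ ^ r ≤ c₂ * t ^ r := mul_le_mul_of_nonneg_left (pow_le_pow_left₀ ht₁.le htt r) hc₂
  calc c₁ * t ^ a ≤ (c₂ * t ^ r) * t ^ a := mul_le_mul_of_nonneg_right (h1.trans h2) (pow_nonneg (ht₁.le.trans htt) _)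
    _ = c₂ * (t ^ a * t ^ r) := by ring

/-- monomial comparison moves left when the left-hand degree is larger. [folklore] -/
theorem mono_cmp_left {c₁ c₂ t₂ t : ℝ} {a b : ℕ} (hc₁ : 0 ≤ c₁) (hba : b ≤ a) (ht : 0 < t) (htt : t ≤ t₂)
    (H : c₁ * t₂ ^ a ≤ c₂ * t₂ ^ b) : c₁ * t ^ a ≤ c₂ * t ^ b := by
  obtain ⟨r, rfl⟩ := Nat.exists_eq_add_of_le hba
  have ht₂ : 0 < t₂ := lt_of_lt_of_le ht htt
  rw [pow_add] at H ⊢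
  have h1 : c₁ * t₂ ^ r ≤ c₂ := by
    have H' : (c₁ * t₂ ^ r) * t₂ ^ b ≤ c₂ * t₂ ^ b := by
      calc (c₁ * t₂ ^ r) * t₂ ^ b = c₁ * (t₂ ^ b * t₂ ^ r) := by ring
        _ ≤ c₂ * t₂ ^ b := H
    exact le_of_mul_le_mul_right H' (pow_pos ht₂ _)
  have h2 : c₁ * t ^ r ≤ c₁ * t₂ ^ r := mul_le_mul_of_nonneg_left (pow_le_pow_left₀ ht.le htt r) hc₁
  calc c₁ * (t ^ b * t ^ r) = (c₁ * t ^ r) * t ^ b := by ring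
    _ ≤ c₂ * t ^ b := mul_le_mul_of_nonneg_right (h2.trans h1) (pow_nonneg ht.le _)

/-- the integer gap `2E + 1 ≤ A + C` gives `16 (K B^E)² ≤ B^A · B^C` once `B ≥ 16K²`. [folklore] -/
theorem pow_gap16 {B : ℝ} (hB1 : 1 < B) (h16 : 16 * (K : ℝ) ^ 2 ≤ B) {E A C : ℤ} (H : 2 * E + 1 ≤ A + C) :
    16 * ((K : ℝ) * B ^ E) ^ 2 ≤ B ^ A * B ^ C := by
  have hB0 : 0 < B := lt_trans zero_lt_one hB1
  calc 16 * ((K : ℝ) * B ^ E) ^ 2 = (16 * (K : ℝ) ^ 2) * (B ^ E) ^ 2 := by ring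
    _ ≤ B * (B ^ E) ^ 2 := mul_le_mul_of_nonneg_right h16 (sq_nonneg _)
    _ = B ^ (2 * E + 1) := by
        rw [← zpow_natCast (B ^ E) 2, ← zpow_mul, mul_comm, ← zpow_add_one₀ hB0.ne']; push_cast; ring_nf
    _ ≤ B ^ (A + C) := zpow_le_zpow_right₀ hB1.le H
    _ = B ^ A * B ^ C := zpow_add₀ hB0.ne' A C

/-- the integer gap `A + C + 1 ≤ 2E` gives `16 (K B^A)(K B^C) ≤ (B^E)²` once `B ≥ 16K²`. [folklore] -/
theorem pow_gap16' {B : ℝ} (hB1 : 1 < B) (h16 : 16 * (K : ℝ) ^ 2 ≤ B) {E A C : ℤ} (H : A + C + 1 ≤ 2 * E) :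
    16 * (((K : ℝ) * B ^ A) * ((K : ℝ) * B ^ C)) ≤ (B ^ E) ^ 2 := by
  have hB0 : 0 < B := lt_trans zero_lt_one hB1
  calc 16 * (((K : ℝ) * B ^ A) * ((K : ℝ) * B ^ C)) = (16 * (K : ℝ) ^ 2) * (B ^ A * B ^ C) := by ring
    _ ≤ B * (B ^ A * B ^ C) := mul_le_mul_of_nonneg_right h16 (by positivity)
    _ = B ^ (A + C + 1) := by rw [← zpow_add₀ hB0.ne', mul_comm, ← zpow_add_one₀ hB0.ne']
    _ ≤ B ^ (2 * E) := zpow_le_zpow_right₀ hB1.le H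
    _ = (B ^ E) ^ 2 := by rw [← zpow_natCast (B ^ E) 2, ← zpow_mul, mul_comm]; push_cast; ring_nf

end Summit.ValiantsHypothesis.ValiantsHypothesis.Theorems.LacunarySymmetroidMatrixDescartes.VSQ
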